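import Summits.QuantumFields.YangMills.Theorems.LuscherReductionTwistedTraceScalingInnerKernelComparison
import HarnessLib

/-!
# Negative-side bookkeeping R19 for C4 INNER, brick D0 (`…InnerKernelComparison`, p603254): a GLOBAL two-sided relative kernel comparison
# `|K₂ − s·K₁| ≤ η·s·K₁` PINS the diagonal ratio `K₂(x,x)/K₁(x,x)` to `[(1−η)s, (1+η)s]` — so `η` is at least half the relative oscillation of that ratio over the region
# (crux `TwistedTraceScaling` stmt-QuantumFields-20203, skeleton «twolattice» rev 3, stub S-BASE, sub-target C4; disprover cycle 16, `Cruxes/TwistedTraceScaling/Disproof.lean` §T5)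

Lane A's brick D0 (`KernelComparison.abs_form_sub_le_of_kernel_near`) transfers one-site min–max levels to the diagonal Born–Oppenheimer block `K_eff` from the pointwise
hypothesis `hnear : ∀ x y, |K₂ x y − s * K₁ x y| ≤ η * s * K₁ x y` with `η = o(λ_b)` (COARSE-DESIGN §21.3/§21.5 D: `K_eff = σ·K₁·(1 + O(β^{−1/2}·polylog))` «pointwise on the
bulk»).  The hypothesis is GLOBAL in `(x, y)`.  This file records the elementary converse information it carries: at every diagonal point the ratio
`ρ(x) = K₂(x,x)/K₁(x,x)` lies in `[(1−η)s, (1+η)s]` (`ratio_bounds_of_kernel_near`), hence for any two points `(1−η)ρ(y) ≤ (1+η)ρ(x)` (`ratio_osc_of_kernel_near`), and if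
the ratio oscillates by a factor `1 + κ` over the region then `κ/(2+κ) ≤ η` (`eta_ge_of_ratio_osc`).  READING (paper, Disproof §T5): for `K₂ = K_eff(c,c')`, `K₁` the one-site
kernel, `ρ(c) = σ(c)` is the stiff Gaussian factor whose `c`-dependence is second order, `|log σ(c)/σ(0)| ≍ |c|²` (lane A's §21.2 / brick Y); on the door's box
`orbitDist < β^{−p}`, `p < 2/51`, the oscillation is `κ ≍ β^{−2p} ≫ λ_b ≍ β^{−1/3}`, so D0 can be fed with `η = o(λ_b)` only on `|c| ≲ β^{−1/6−0}` — a slow cut («brick R») is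
then load-bearing for arbitrary test families in the box.  Nothing here refutes D0 (it is unconditional and correct); this is its tightness in `η`.
HONEST FRAMING: elementary real inequalities about a stub (S-BASE, C4) of a child of the CONDITIONAL reduction route R2b1; not `¬TwistedTraceScaling`, not a gap, not Clay.

## References
* B. Helffer, *Spectral Theory and its Applications*, CUP 2013, Lemma 7.1 (Schur's test). [Helffer2013]
* M. Lüscher, Nucl. Phys. B219 (1983) 233, §3. [Luscher1983]
-/

set_option autoImplicit false

namespace Summit.QuantumFields.YangMills.Theorems.TwistedTraceScaling.Negative.R19

variable {X : Type*}

/-- `hnear` at a diagonal point with `s·K₁(x,x) > 0` forces `0 ≤ η`. [folklore] -/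
theorem eta_nonneg_of_kernel_near {K₁ K₂ : X → X → ℝ} {s η : ℝ} (hnear : ∀ x y, |K₂ x y - s * K₁ x y| ≤ η * s * K₁ x y)
    {x : X} (hs : 0 < s) (hx : 0 < K₁ x x) : 0 ≤ η := by
  have h := (abs_nonneg _).trans (hnear x x)
  have hsK : 0 < s * K₁ x x := mul_pos hs hx
  by_contra hη
  have hη : η < 0 := lt_of_not_ge hη
  have : η * s * K₁ x x < 0 := by
    have e : η * s * K₁ x x = η * (s * K₁ x x) := by ring
    rw [e]
    exact mul_neg_of_neg_of_pos hη hsK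
  linarith

/-- **The diagonal ratio is pinned**: `(1−η)·s ≤ K₂(x,x)/K₁(x,x) ≤ (1+η)·s` at every point with `K₁(x,x) > 0`. [cite: Helffer2013, Lemma 7.1] -/
theorem ratio_bounds_of_kernel_near {K₁ K₂ : X → X → ℝ} {s η : ℝ} (hnear : ∀ x y, |K₂ x y - s * K₁ x y| ≤ η * s * K₁ x y)
    {x : X} (hx : 0 < K₁ x x) :
    (1 - η) * s ≤ K₂ x x / K₁ x x ∧ K₂ x x / K₁ x x ≤ (1 + η) * s := by
  have h := abs_le.1 (hnear x x)
  constructor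
  · rw [le_div_iff₀ hx]
    nlinarith [h.1]
  · rw [div_le_iff₀ hx]
    nlinarith [h.2]

/-- **Oscillation bound**: for any two diagonal points, `(1−η)·ρ(y) ≤ (1+η)·ρ(x)` (`ρ = K₂/K₁` on the diagonal; `η ≤ 1`, `s > 0`). [cite: Helffer2013, Lemma 7.1] -/
theorem ratio_osc_of_kernel_near {K₁ K₂ : X → X → ℝ} {s η : ℝ} (hnear : ∀ x y, |K₂ x y - s * K₁ x y| ≤ η * s * K₁ x y)
    (hs : 0 < s) (hη : η ≤ 1) {x y : X} (hx : 0 < K₁ x x) (hy : 0 < K₁ y y) :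
    (1 - η) * (K₂ y y / K₁ y y) ≤ (1 + η) * (K₂ x x / K₁ x x) := by
  have hη0 : 0 ≤ η := eta_nonneg_of_kernel_near hnear hs hx
  have h1 : (1 - η) * s ≤ K₂ x x / K₁ x x := (ratio_bounds_of_kernel_near hnear hx).1
  have h2 : K₂ y y / K₁ y y ≤ (1 + η) * s := (ratio_bounds_of_kernel_near hnear hy).2
  have h1η : 0 ≤ 1 - η := by linarith
  calc (1 - η) * (K₂ y y / K₁ y y) ≤ (1 - η) * ((1 + η) * s) := mul_le_mul_of_nonneg_left h2 h1η
    _ = (1 + η) * ((1 - η) * s) := by ring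
    _ ≤ (1 + η) * (K₂ x x / K₁ x x) := mul_le_mul_of_nonneg_left h1 (by linarith)

/-- ★ **TIGHTNESS of D0 in `η`**: if the diagonal ratio oscillates by a factor `1 + κ` over the region — `(1+κ)·ρ(x) ≤ ρ(y)` with `ρ(x) > 0` — then every
GLOBAL two-sided relative comparison has `κ/(2+κ) ≤ η`.  (For `K₂ = K_eff`, `K₁` one-site on the box `orbitDist < β^{−p}`: `κ ≍ β^{−2p} ≫ λ_b`, Disproof §T5.)
[cite: Luscher1983, §3] -/
theorem eta_ge_of_ratio_osc {K₁ K₂ : X → X → ℝ} {s η κ : ℝ} (hnear : ∀ x y, |K₂ x y - s * K₁ x y| ≤ η * s * K₁ x y)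
    (hs : 0 < s) (hη : η ≤ 1) {x y : X} (hx : 0 < K₁ x x) (hy : 0 < K₁ y y) (hρx : 0 < K₂ x x) (hκ : -2 < κ)
    (hosc : (1 + κ) * (K₂ x x / K₁ x x) ≤ K₂ y y / K₁ y y) :
    κ / (2 + κ) ≤ η := by
  have hη0 : 0 ≤ η := eta_nonneg_of_kernel_near hnear hs hx
  have hρ : 0 < K₂ x x / K₁ x x := div_pos hρx hx
  have h := ratio_osc_of_kernel_near hnear hs hη hx hy
  -- `(1−η)(1+κ)ρ(x) ≤ (1+η)ρ(x)`, divide by `ρ(x) > 0`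
  have h' : (1 - η) * ((1 + κ) * (K₂ x x / K₁ x x)) ≤ (1 + η) * (K₂ x x / K₁ x x) :=
    (mul_le_mul_of_nonneg_left hosc (by linarith)).trans h
  have h'' : (1 - η) * (1 + κ) ≤ 1 + η := by
    have e1 : (1 - η) * ((1 + κ) * (K₂ x x / K₁ x x)) = ((1 - η) * (1 + κ)) * (K₂ x x / K₁ x x) := by ring
    rw [e1] at h'
    exact le_of_mul_le_mul_right h' hρ
  rw [div_le_iff₀ (by linarith)]
  nlinarith

/-- Concretely: a ratio oscillation by the factor `1 + κ` with `0 ≤ κ ≤ 1` forces `κ/3 ≤ η` — so `η = o(λ_b)` needs the oscillation itself to be `o(λ_b)`. [folklore] -/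
theorem eta_ge_third_of_ratio_osc {K₁ K₂ : X → X → ℝ} {s η κ : ℝ} (hnear : ∀ x y, |K₂ x y - s * K₁ x y| ≤ η * s * K₁ x y)
    (hs : 0 < s) (hη : η ≤ 1) {x y : X} (hx : 0 < K₁ x x) (hy : 0 < K₁ y y) (hρx : 0 < K₂ x x) (hκ0 : 0 ≤ κ) (hκ1 : κ ≤ 1)
    (hosc : (1 + κ) * (K₂ x x / K₁ x x) ≤ K₂ y y / K₁ y y) :
    κ / 3 ≤ η := by
  have h := eta_ge_of_ratio_osc hnear hs hη hx hy hρx (by linarith) hosc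
  have h3 : κ / 3 ≤ κ / (2 + κ) := by
    rw [div_le_div_iff₀ (by norm_num) (by linarith)]
    nlinarith
  exact h3.trans h

end Summit.QuantumFields.YangMills.Theorems.TwistedTraceScaling.Negative.R19
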